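/-
Copyright (c) 2026. All rights reserved.
Released under Apache 2.0 license as described in the file LICENSE.
Authors: abc-iut cell, wave-4 prover seat abc-iut-w4-d050 (proof-only; over abc-iut-L5-t1's
`GlobalFrobenioidsModel.lean`, abc-iut-found's [FrdI] Prop 1.6 and this seat's
`GlobalFrobenioidsFrobenioidStructure.lean`).
-/
import Literature.IUT.HodgeTheaters.GlobalFrobenioidsFrobenioidStructure
import Literature.AlgebraicGeometry.Frobenioids.FSMIMorphisms
import HarnessLib

/-!
# [IUTchI] Example 5.1 (iii), last clause: `†ℱ^⊛_mod` — "the Frobenioid of arithmetic line bundles on the stack `S_mod`" — IS a Frobenioid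

S. Mochizuki, *Inter-universal Teichmüller theory I*, §5, Example 5.1 (iii) (kurims manuscript, May
2020, p. 126): "`†ℱ^⊛_mod := †ℱ^⊛|_{terminal objects} (⊆ †ℱ^⊛)` the restriction of `†ℱ^⊛` to the full
subcategory of `†𝒟^⊛` determined by the terminal objects [i.e., "`C_{F_mod}`"] of `†𝒟^⊛`.  Thus … the
Frobenioid `†ℱ^⊛_mod` may be thought of as the Frobenioid of arithmetic line bundles on the stack `S_mod`".

Seat abc-iut-L5-t1 typed `†ℱ^⊛_mod` LITERALLY (`GlobalFrobenioidsModel.lean`, p404939):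
`GlobalFrobenioid.Fmod := (F.overTerminal).FullSubcategory`, the objects of `†ℱ^⊛` whose (identified)
base object of `†𝒟^⊛ = ℬ(G)⁰` is terminal.  This PROOF-ONLY file shows that `†ℱ^⊛_mod` IS a Frobenioid
(of isotropic type) — under ONLY the printed [FrdI] Thm 5.2 hypotheses on the divisor data `(Φ^⊛, 𝔹)`
(BY NAME, as in `GlobalFrobenioidsFrobenioidStructure.lean`), every base-change hypothesis being
DISCHARGED here:

* `exists_isTerminal_baseCat`: `†𝒟^⊛ = ℬ(G)⁰` HAS a terminal object — the one-point `G`-set ("`C_{F_mod}`",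
  p. 123 "a profinite group corresponding to `C_{F_mod}`": in `ℬ(π₁(†𝒟^⊛))⁰` the curve `C_{F_mod}` itself is
  the terminal object);
* the full subcategory of terminal objects of `ℬ(G)⁰` is connected and totally epimorphic and its
  inclusion maps FSM-morphisms to FSM-morphisms (they are isomorphisms; abc-iut-found's
  `IsFSM.of_isIso`) — the three hypotheses of [FrdI] Prop 1.6 (`isGraphConnected_terminalPart`,
  `isTotallyEpimorphic_terminalPart`, `isFSM_terminalPart_ι_map`);
* `exists_fmod_equivalence_fiberProduct`: t1's literal `†ℱ^⊛_mod` is equivalent — by an equivalence that is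
  the identity on the `†ℱ^⊛`-component — to the [FrdI] §0 / Prop 1.6 categorical fibre product of
  `†ℱ^⊛ → F_{Φ^⊛} → †𝒟^⊛` with that inclusion (the base component of an object of `†ℱ^⊛_mod` being terminal,
  it is recovered up to unique isomorphism);
* `fmod_isFrobenioid`: hence ([FrdI] Prop 1.6 (ii) `PreFrobenioid.isFrobenioid_fiberProduct` + "a category
  equivalent to a Frobenioid is a Frobenioid" `PreFrobenioid.IsFrobenioid.comp_equivalence`) the structure
  functor `†ℱ^⊛_mod → F_{Φ^⊛|_{terminal objects}}` induced through that equivalence is a Frobenioid.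

Theorems only; no definitions (the object property "is terminal" is written inline); no new named
facts; nothing here bears on [IUTchIII] Cor. 3.12.  [claim: Mochizuki2012, status: disputed] for the
reading of (iii); the mathematics is [cite: MochizukiFrdI2008, Prop. 1.6 p.27] and
[cite: MochizukiFrdI2008, Thm. 5.2(ii) p.101].
-/

namespace Literature.IUT.HodgeTheaters

open CategoryTheory CategoryTheory.Limits Literature.AlgebraicGeometry.Frobenioids

universe u

/-! ### `†𝒟^⊛ = ℬ(G)⁰` has a terminal object, and its terminal objects form a connected, totally
epimorphic full subcategory whose morphisms are FSM -/

/-- `†𝒟^⊛ = ℬ(π₁(†𝒟^⊛))⁰` HAS a terminal object: the one-point `G`-set (every connected finite `G`-set maps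
to it, uniquely) — the "`C_{F_mod}`" of [IUTchI] Ex 5.1 (i) p. 123 / (iii) p. 126 ("the terminal objects
[i.e., `C_{F_mod}`] of `†𝒟^⊛`"). ([IUTchI] Ex 5.1 (iii) p.126) [claim: Mochizuki2012, status: disputed] -/
theorem exists_isTerminal_baseCat (G : ProfiniteGrp.{u}) :
    ∃ T : BaseCat G, Nonempty (IsTerminal T) := by
  obtain ⟨T, t₀, hT, ht⟩ := NFLocCat.exists_point_obj G
  have hpt : ∀ a b : T.obj.V, a = b := fun a b => (ht a).trans (ht b).symm
  let toT : ∀ X : BaseCat G, X ⟶ (⟨T, hT⟩ : BaseCat G) := fun X =>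
    ObjectProperty.homMk (ObjectProperty.homMk
      { hom := FintypeCat.homMk fun _ => t₀
        comm := fun _ => FintypeCat.hom_ext _ _ fun _ => hpt _ _ })
  exact ⟨⟨T, hT⟩, ⟨IsTerminal.ofUniqueHom toT fun X m =>
    ObjectProperty.hom_ext _ (BCat.hom_ext_apply fun _ => hpt _ _)⟩⟩

/-- The full subcategory of TERMINAL objects of `†𝒟^⊛ = ℬ(G)⁰` ("the full subcategory of `†𝒟^⊛` determined
by the terminal objects", p. 126) is connected ([FrdI] §0): it is nonempty and any two terminal objects
are isomorphic. ([IUTchI] Ex 5.1 (iii) p.126; [FrdI] Prop 1.6 hypothesis) [claim: Mochizuki2012, status: disputed] -/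
theorem isGraphConnected_terminalPart (G : ProfiniteGrp.{u}) :
    IsGraphConnected
      (ObjectProperty.FullSubcategory (fun X : BaseCat G => Nonempty (IsTerminal X))) := by
  obtain ⟨T, ⟨hT⟩⟩ := exists_isTerminal_baseCat G
  refine ⟨⟨⟨T, ⟨hT⟩⟩⟩, fun X Y => ?_⟩
  exact Zigzag.of_hom (ObjectProperty.homMk (X.property.some.uniqueUpToIso Y.property.some).hom)

/-- That full subcategory is totally epimorphic ([FrdI] §0): two morphisms into a terminal object agree.
([IUTchI] Ex 5.1 (iii) p.126; [FrdI] Prop 1.6 hypothesis) [claim: Mochizuki2012, status: disputed] -/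
theorem isTotallyEpimorphic_terminalPart (G : ProfiniteGrp.{u}) :
    IsTotallyEpimorphic
      (ObjectProperty.FullSubcategory (fun X : BaseCat G => Nonempty (IsTerminal X))) :=
  ⟨fun {_ _} _ => ⟨fun {Z} g h _ => ObjectProperty.hom_ext _ (Z.property.some.hom_ext g.hom h.hom)⟩⟩

/-- The inclusion of that full subcategory maps FSM-morphisms to FSM-morphisms ([FrdI] Prop 1.6: "`D′ → D`
a functor that maps FSM-morphisms to FSM-morphisms"): a morphism between terminal objects is an
isomorphism of `ℬ(G)⁰`, hence FSM (abc-iut-found's `IsFSM.of_isIso`).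
([IUTchI] Ex 5.1 (iii) p.126; [FrdI] Prop 1.6 hypothesis) [claim: Mochizuki2012, status: disputed] -/
theorem isFSM_terminalPart_ι_map (G : ProfiniteGrp.{u})
    {A B : ObjectProperty.FullSubcategory (fun X : BaseCat G => Nonempty (IsTerminal X))}
    (f : B ⟶ A) :
    IsFSM ((ObjectProperty.ι (fun X : BaseCat G => Nonempty (IsTerminal X))).map f) := by
  haveI : IsIso f.hom :=
    ⟨⟨B.property.some.from A.obj, B.property.some.hom_ext _ _, A.property.some.hom_ext _ _⟩⟩
  exact IsFSM.of_isIso f.hom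

/-! ### `†ℱ^⊛_mod` versus the [FrdI] Prop 1.6 fibre product, and its Frobenioid structure -/

namespace GlobalFrobenioid

variable {G : ProfiniteGrp.{u}} {Δ : GlobalDivisorData G} {Dcirc : Type (u + 1)}
  [Category.{u} Dcirc] {toBase0 : Dcirc ⥤ BaseCat G} (F : GlobalFrobenioid Δ Dcirc toBase0)

/-- **t1's literal `†ℱ^⊛_mod = GlobalFrobenioid.Fmod` versus the [FrdI] Prop 1.6 fibre product along the
inclusion of the terminal objects of `†𝒟^⊛`.**  `†ℱ^⊛_mod` was typed as the full subcategory of `†ℱ^⊛` on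
the objects whose identified base (`identify (toBase A)`) is terminal; transported along
`toBase_compat : toBase ⋙ identify ≅ equiv ⋙ (ℱ^⊛(†𝒟^⊚) → †𝒟^⊛)` this is "the base of `A` under the
structure functor is terminal", and since a terminal base is recovered up to unique isomorphism, the
§0 fibre product `†ℱ^⊛ ×_{†𝒟^⊛} {terminal objects}` is equivalent to it by an equivalence that is the
IDENTITY on the `†ℱ^⊛`-component (bookkeeping; stated as an existence so that no definition is added).
([IUTchI] Ex 5.1 (iii) p.126) [claim: Mochizuki2012, status: disputed] -/
theorem exists_fmod_equivalence_fiberProduct :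
    ∃ e : F.Fmod ≌ PreFrobenioid.FiberProduct
        (F.equiv.functor ⋙ ModelFrobenioid.toElem Δ.Φ Δ.B Δ.div)
        (ObjectProperty.ι (fun X : BaseCat G => Nonempty (IsTerminal X))),
      ∀ A, (e.functor.obj A).fst = A.obj := by
  let S := F.equiv.functor ⋙ ModelFrobenioid.toElem Δ.Φ Δ.B Δ.div
  let P : ObjectProperty (BaseCat G) := fun X => Nonempty (IsTerminal X)
  -- the identification `Base(†ℱ^⊛) ⥲ †𝒟^⊛` on objects of `†ℱ^⊛`, with normalised types
  let cI : ∀ A : F.cat, F.identify.functor.obj (F.toBase.obj A) ≅ Δ.modelBase.obj (F.equiv.functor.obj A) :=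
    fun A => F.toBase_compat.app A
  -- terminality transported in both directions
  have hfwd : ∀ A : F.Fmod, P (Δ.modelBase.obj (F.equiv.functor.obj A.obj)) :=
    fun A => ⟨A.property.some.ofIso (cI A.obj)⟩
  have hbwd : ∀ Y : PreFrobenioid.FiberProduct S P.ι, F.overTerminal Y.fst := fun Y =>
    ⟨(Y.snd.property.some.ofIso Y.iso.symm).ofIso (cI Y.fst).symm⟩
  -- forward and backward functors
  let fwd : F.Fmod ⥤ PreFrobenioid.FiberProduct S P.ι :=
    { obj := fun A => ⟨A.obj, ⟨Δ.modelBase.obj (F.equiv.functor.obj A.obj), hfwd A⟩, Iso.refl _⟩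
      map := fun {A B} f => ⟨f.hom, ObjectProperty.homMk (Δ.modelBase.map (F.equiv.functor.map f.hom)), by
        change Δ.modelBase.map (F.equiv.functor.map f.hom) ≫ 𝟙 _ =
          𝟙 _ ≫ Δ.modelBase.map (F.equiv.functor.map f.hom)
        rw [Category.comp_id, Category.id_comp]⟩
      map_id := fun A => CFP.hom_ext rfl (ObjectProperty.hom_ext _ (by
        change Δ.modelBase.map (F.equiv.functor.map (𝟙 A.obj)) = 𝟙 _
        rw [F.equiv.functor.map_id, Δ.modelBase.map_id]))
      map_comp := fun f g => CFP.hom_ext rfl (ObjectProperty.hom_ext _ (by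
        change Δ.modelBase.map (F.equiv.functor.map (f.hom ≫ g.hom)) = _ ≫ _
        rw [F.equiv.functor.map_comp, Δ.modelBase.map_comp]
        rfl)) }
  let bwd : PreFrobenioid.FiberProduct S P.ι ⥤ F.Fmod :=
    { obj := fun Y => ⟨Y.fst, hbwd Y⟩
      map := fun {X Y} g => ObjectProperty.homMk g.fst
      map_id := fun X => rfl
      map_comp := fun f g => rfl }
  -- unit: identity
  let η : 𝟭 F.Fmod ≅ fwd ⋙ bwd := NatIso.ofComponents (fun A => Iso.refl _)
    (fun {A B} f => by
      change f ≫ 𝟙 _ = 𝟙 _ ≫ ObjectProperty.homMk f.hom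
      rw [Category.comp_id, Category.id_comp]
      rfl)
  -- counit: identity on the first component, the base component's iso on the second
  let ε : bwd ⋙ fwd ≅ 𝟭 _ := NatIso.ofComponents
    (fun Y => CFP.isoMk (Iso.refl _) (P.isoMk Y.iso) (by
      change Δ.modelBase.map (F.equiv.functor.map (𝟙 Y.fst)) ≫ Y.iso.hom = 𝟙 _ ≫ Y.iso.hom
      rw [F.equiv.functor.map_id, Δ.modelBase.map_id]
      rfl))
    (fun {X Y} g => CFP.hom_ext
      (by change g.fst ≫ 𝟙 _ = 𝟙 _ ≫ g.fst; rw [Category.comp_id, Category.id_comp])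
      (ObjectProperty.hom_ext _ (by
        change Δ.modelBase.map (F.equiv.functor.map g.fst) ≫ Y.iso.hom = X.iso.hom ≫ g.snd.hom
        exact g.w)))
  exact ⟨CategoryTheory.Equivalence.mk fwd bwd η ε, fun A => rfl⟩

/-- **[IUTchI] Ex 5.1 (iii), last clause: `†ℱ^⊛_mod` IS a Frobenioid** ("the Frobenioid `†ℱ^⊛_mod` …
the Frobenioid of arithmetic line bundles on the stack `S_mod`", p. 126): the structure functor
`†ℱ^⊛_mod → F_{Φ^⊛|_{terminal objects}}` induced through the identity-on-objects equivalence of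
`exists_fmod_equivalence_fiberProduct` with the [FrdI] Prop 1.6 fibre product is a Frobenioid — [FrdI]
Prop 1.6 (ii) (abc-iut-found `PreFrobenioid.isFrobenioid_fiberProduct`) over `isFrobenioid_equivToElem`,
its three base-change hypotheses DISCHARGED (`isGraphConnected_terminalPart`,
`isTotallyEpimorphic_terminalPart`, `isFSM_terminalPart_ι_map`); only the printed [FrdI] Thm 5.2
divisor-data hypotheses (`Φ^⊛` divisorial, `𝔹` group-like — [FrdI] Ex 6.3) remain, BY NAME.
([IUTchI] Ex 5.1 (iii) p.126) [claim: Mochizuki2012, status: disputed] -/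
theorem fmod_isFrobenioid (hΦ : IsMonoidOn Δ.Φ)
    (hΦd : Objectwise (fun M _ => IsDivisorial M) Δ.Φ) (hB : IsMonoidOn Δ.B)
    (hBg : Objectwise (fun M _ => IsGroupLike M) Δ.B) :
    ∃ e : F.Fmod ≌ PreFrobenioid.FiberProduct
        (F.equiv.functor ⋙ ModelFrobenioid.toElem Δ.Φ Δ.B Δ.div)
        (ObjectProperty.ι (fun X : BaseCat G => Nonempty (IsTerminal X))),
      (∀ A, (e.functor.obj A).fst = A.obj) ∧
      PreFrobenioid.IsFrobenioid (e.functor ⋙ PreFrobenioid.fiberProductFunctor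
        (F.equiv.functor ⋙ ModelFrobenioid.toElem Δ.Φ Δ.B Δ.div)
        (ObjectProperty.ι (fun X : BaseCat G => Nonempty (IsTerminal X)))) := by
  obtain ⟨e, he⟩ := F.exists_fmod_equivalence_fiberProduct
  refine ⟨e, he, PreFrobenioid.IsFrobenioid.comp_equivalence e ?_⟩
  exact PreFrobenioid.isFrobenioid_fiberProduct (F.isFrobenioid_equivToElem hΦ hΦd hB hBg)
    (isGraphConnected_terminalPart G) (isTotallyEpimorphic_terminalPart G)
    (fun f _ => isFSM_terminalPart_ι_map G f)

/-- … and that Frobenioid structure on `†ℱ^⊛_mod` is of ISOTROPIC type ([FrdI] Thm 5.2 (ii) / Prop 1.6 (v):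
an object of the fibre product is isotropic iff its `†ℱ^⊛`-component is).
([IUTchI] Ex 5.1 (iii) p.126) [claim: Mochizuki2012, status: disputed] -/
theorem fmod_isOfIsotropicType (hΦ : IsMonoidOn Δ.Φ)
    (hΦd : Objectwise (fun M _ => IsDivisorial M) Δ.Φ) (hB : IsMonoidOn Δ.B)
    (hBg : Objectwise (fun M _ => IsGroupLike M) Δ.B) :
    ∃ e : F.Fmod ≌ PreFrobenioid.FiberProduct
        (F.equiv.functor ⋙ ModelFrobenioid.toElem Δ.Φ Δ.B Δ.div)
        (ObjectProperty.ι (fun X : BaseCat G => Nonempty (IsTerminal X))),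
      PreFrobenioid.IsFrobenioid (e.functor ⋙ PreFrobenioid.fiberProductFunctor
        (F.equiv.functor ⋙ ModelFrobenioid.toElem Δ.Φ Δ.B Δ.div)
        (ObjectProperty.ι (fun X : BaseCat G => Nonempty (IsTerminal X)))) ∧
      PreFrobenioid.IsOfIsotropicType (e.functor ⋙ PreFrobenioid.fiberProductFunctor
        (F.equiv.functor ⋙ ModelFrobenioid.toElem Δ.Φ Δ.B Δ.div)
        (ObjectProperty.ι (fun X : BaseCat G => Nonempty (IsTerminal X)))) := by
  obtain ⟨e, -, he⟩ := F.fmod_isFrobenioid hΦ hΦd hB hBg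
  refine ⟨e, he, PreFrobenioid.isOfIsotropicType_comp_equivalence e ?_⟩
  intro Y
  exact (PreFrobenioid.isIsotropic_fiberProduct_iff Y).mpr
    (F.isOfIsotropicType_equivToElem hBg Y.fst)

end GlobalFrobenioid

end Literature.IUT.HodgeTheaters
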